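import Literature.NumberTheory.Transcendental.LinGroupKRoyGlue
import Literature.NumberTheory.Transcendental.AlgebraicSizeBookkeeping
import HarnessLib

/-!
# Denominators and houses of the values of words of invariant derivations at the points `γ(h)`

Topic `Literature/NumberTheory/Transcendental` (namespace `Literature.NumberTheory.Transcendental`,
grouping sub-namespace `LinGroupK`). Everything here is PROVED; no definitions, no named facts.

The arithmetic half of the `p`-adic (and of any) proof of Waldschmidt's Theorem 4.1 on
`𝔾ₐ^{d₀} × 𝔾ₘ^{d₁}` needs, for the Liouville step, the two sizes of the algebraic numbers
`ξ = (D_u P)(γ(h))` — a word `D_u = D_{u₁} ⋯ D_{u_ℓ}` of invariant derivations (`ℓ < T`) applied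
to the auxiliary polynomial `P = ∑ q_s X^{s₀}Y^{s₁}` (`q_s ∈ ℤ`, `|q_s| ≤ Q`, `deg_X ≤ D₀`,
`deg_Y ≤ D₁`) and evaluated at `γ(h) = (∑ hᵢ yᵢ⁰, (∏ αᵢⱼ^{hᵢ})ⱼ)`, `0 ≤ hᵢ ≤ S` — in a number
field `k` containing the coordinates of the `yᵢ⁰`, the `αᵢⱼ` and the letters `u_l`
([Waldschmidt1988, §6, p. 389]: "the usual estimates for the denominators and the houses").
In the calculus `AlgSize.IsGood d N B` of `AlgebraicSizeBookkeeping.lean` (`d^N ξ ∈ 𝓞_k` with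
all conjugates `≤ B`), with all generators good for `(d, 1, C)`, `C ≥ 1`:

* `coeff_invDeriv` — the coefficients of `D_w R`:
  `coeff_s(D_w R) = ∑ᵢ (sᵢ + 1) wᵢ⁰ coeff_{s+eᵢ}(R) + (∑ⱼ s₁ⱼ wⱼ¹) coeff_s(R)`;
  `degX_invDeriv_le`, `degY_invDeriv_le`, `degX_wordDeriv_le`, `degY_wordDeriv_le` — words do not
  raise degrees;
* `isGood_coeff_invDeriv`, `isGood_coeff_wordDeriv` — one letter costs a factor
  `C (d₀(D₀+1) + D₁ + 1)` on the house and `1` on the denominator exponent: the coefficients of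
  `D_u P` are good for `(d, ℓ, Q (C(d₀(D₀+1)+D₁+1))^ℓ)`;
* `isGood_evalAt_gammaOf` — evaluation at `γ(h)` costs `(d, D₀ + D₁ m S, …)`: altogether
  `(D_u P)(γ(h))` is good with denominator exponent `ℓ + D₀ + D₁ m S` and an explicit house whose
  logarithm is `≪ log Q + ℓ log(C D₀ D₁) + D₀ log(m S C) + m S D₁ log(|d| C)` — the bound used in
  the choice of parameters of [Waldschmidt1988, §6 Prop. 6.1].

## References

* [Waldschmidt1988] M. Waldschmidt, *On the transcendence methods of Gel'fond and Schneider in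
  several variables*, New Advances in Transcendence Theory (A. Baker ed.), CUP 1988, 375–398, §6
  (p. 389).
* M. Waldschmidt, *Diophantine Approximation on Linear Algebraic Groups*, Grundlehren 326,
  Springer 2000, §§3.4–3.5.
-/

noncomputable section

open MvPolynomial Finset

namespace Literature.NumberTheory.Transcendental

namespace LinGroupK

section Generic

variable {K : Type*} [Field K] {d₀ d₁ : ℕ}

/-! ### Coefficients and degrees of `D_w R` -/

/-- **The coefficients of `D_w R`**:
`coeff_s(D_w R) = ∑ᵢ (sᵢ + 1) wᵢ⁰ coeff_{s+eᵢ}(R) + (∑ⱼ s₁ⱼ wⱼ¹) coeff_s(R)`. [folklore] -/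
theorem coeff_invDeriv (w : (Fin d₀ → K) × (Fin d₁ → K)) (R : MvPolynomial (Fin d₀ ⊕ Fin d₁) K)
    (s : Fin d₀ ⊕ Fin d₁ →₀ ℕ) :
    coeff s (invDeriv w R) =
      ∑ i, ((s (Sum.inl i) : K) + 1) * w.1 i * coeff (s + Finsupp.single (Sum.inl i) 1) R +
        (∑ j, (s (Sum.inr j) : K) * w.2 j) * coeff s R := by
  classical
  rw [invDeriv_apply, coeff_add, coeff_sum, coeff_sum, Finset.sum_mul]
  congr 1
  · refine Finset.sum_congr rfl fun i _ => ?_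
    rw [coeff_smul, coeff_pderiv, smul_eq_mul]
    ring
  · refine Finset.sum_congr rfl fun j _ => ?_
    rw [coeff_smul, smul_eq_mul, coeff_X_mul']
    split_ifs with hj
    · rw [coeff_pderiv]
      have hs : s - Finsupp.single (Sum.inr j) 1 + Finsupp.single (Sum.inr j) 1 = s := by
        ext v
        simp only [Finsupp.coe_add, Finsupp.coe_tsub, Pi.add_apply, Pi.sub_apply, Finsupp.single_apply]
        split_ifs with h
        · subst h
          rw [Finsupp.mem_support_iff] at hj
          omega
        · simp
      have hsj : ((s - Finsupp.single (Sum.inr j) 1 : Fin d₀ ⊕ Fin d₁ →₀ ℕ) (Sum.inr j) : K) + 1 =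
          (s (Sum.inr j) : K) := by
        rw [Finsupp.mem_support_iff] at hj
        have : (s - Finsupp.single (Sum.inr j) 1 : Fin d₀ ⊕ Fin d₁ →₀ ℕ) (Sum.inr j) + 1 = s (Sum.inr j) := by
          simp only [Finsupp.coe_tsub, Pi.sub_apply, Finsupp.single_eq_same]
          omega
        have h' := congrArg (Nat.cast : ℕ → K) this
        push_cast at h'
        exact h'
      rw [hs, hsj]
      ring
    · rw [Finsupp.notMem_support_iff] at hj
      rw [hj, Nat.cast_zero, zero_mul, zero_mul, mul_zero]

/-- If `coeff_s(D_w R) ≠ 0` then `coeff_{s+eᵢ}(R) ≠ 0` for some `i`, or `coeff_s(R) ≠ 0`. [folklore] -/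
theorem exists_coeff_ne_zero_of_coeff_invDeriv_ne_zero {w : (Fin d₀ → K) × (Fin d₁ → K)}
    {R : MvPolynomial (Fin d₀ ⊕ Fin d₁) K} {s : Fin d₀ ⊕ Fin d₁ →₀ ℕ} (h : coeff s (invDeriv w R) ≠ 0) :
    (∃ i, coeff (s + Finsupp.single (Sum.inl i) 1) R ≠ 0) ∨ coeff s R ≠ 0 := by
  by_contra hc
  push Not at hc
  apply h
  rw [coeff_invDeriv]
  rw [Finset.sum_eq_zero fun i _ => by rw [hc.1 i, mul_zero], hc.2, mul_zero, add_zero]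

/-- `deg_X(D_w R) ≤ deg_X R`. [folklore] -/
theorem degX_invDeriv_le (w : (Fin d₀ → K) × (Fin d₁ → K)) (R : MvPolynomial (Fin d₀ ⊕ Fin d₁) K) :
    degX (invDeriv w R) ≤ degX R := by
  rw [degX_le_iff]
  intro s hs
  rw [mem_support_iff] at hs
  rcases exists_coeff_ne_zero_of_coeff_invDeriv_ne_zero hs with ⟨i, hi⟩ | h0
  · have h1 := degX_le_iff.1 le_rfl _ (mem_support_iff.2 hi)
    refine le_trans ?_ h1
    refine Finset.sum_le_sum fun i' _ => ?_
    simp only [Finsupp.coe_add, Pi.add_apply, Finsupp.single_apply]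
    split_ifs <;> omega
  · exact degX_le_iff.1 le_rfl _ (mem_support_iff.2 h0)

/-- `deg_Y(D_w R) ≤ deg_Y R`. [folklore] -/
theorem degY_invDeriv_le (w : (Fin d₀ → K) × (Fin d₁ → K)) (R : MvPolynomial (Fin d₀ ⊕ Fin d₁) K) :
    degY (invDeriv w R) ≤ degY R := by
  rw [degY_le_iff]
  intro s hs
  rw [mem_support_iff] at hs
  rcases exists_coeff_ne_zero_of_coeff_invDeriv_ne_zero hs with ⟨i, hi⟩ | h0
  · have h1 := degY_le_iff.1 le_rfl _ (mem_support_iff.2 hi)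
    refine le_trans (le_of_eq ?_) h1
    refine Finset.sum_congr rfl fun j _ => ?_
    simp
  · exact degY_le_iff.1 le_rfl _ (mem_support_iff.2 h0)

/-- Words do not raise `deg_X`. [folklore] -/
theorem degX_wordDeriv_le {ℓ : ℕ} (u : Fin ℓ → (Fin d₀ → K) × (Fin d₁ → K))
    (R : MvPolynomial (Fin d₀ ⊕ Fin d₁) K) : degX (wordDeriv u R) ≤ degX R := by
  induction ℓ generalizing R with
  | zero => exact le_rfl
  | succ ℓ ih => rw [wordDeriv_succ]; exact (ih _ _).trans (degX_invDeriv_le _ _)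

/-- Words do not raise `deg_Y`. [folklore] -/
theorem degY_wordDeriv_le {ℓ : ℕ} (u : Fin ℓ → (Fin d₀ → K) × (Fin d₁ → K))
    (R : MvPolynomial (Fin d₀ ⊕ Fin d₁) K) : degY (wordDeriv u R) ≤ degY R := by
  induction ℓ generalizing R with
  | zero => exact le_rfl
  | succ ℓ ih => rw [wordDeriv_succ]; exact (ih _ _).trans (degY_invDeriv_le _ _)

/-- In the support, every `X`-exponent is `≤ deg_X` and every `Y`-exponent `≤ deg_Y`. [folklore] -/
theorem apply_le_of_mem_support {R : MvPolynomial (Fin d₀ ⊕ Fin d₁) K} {s : Fin d₀ ⊕ Fin d₁ →₀ ℕ}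
    (hs : s ∈ R.support) :
    (∀ i, s (Sum.inl i) ≤ degX R) ∧ ∀ j, s (Sum.inr j) ≤ degY R := by
  constructor
  · intro i
    exact (Finset.single_le_sum (f := fun i => s (Sum.inl i)) (fun _ _ => Nat.zero_le _)
      (Finset.mem_univ i)).trans (degX_le_iff.1 le_rfl s hs)
  · intro j
    exact (Finset.single_le_sum (f := fun j => s (Sum.inr j)) (fun _ _ => Nat.zero_le _)
      (Finset.mem_univ j)).trans (degY_le_iff.1 le_rfl s hs)

/-- **The support of `R` lies in a box**: `card(support R) ≤ (max(deg_X, deg_Y) + 1)^{d₀+d₁}`.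
[folklore] -/
theorem card_support_le (R : MvPolynomial (Fin d₀ ⊕ Fin d₁) K) :
    R.support.card ≤ (max (degX R) (degY R) + 1) ^ (d₀ + d₁) := by
  classical
  set D := max (degX R) (degY R) with hD
  let f : (Fin d₀ ⊕ Fin d₁ →₀ ℕ) → (Fin d₀ ⊕ Fin d₁ → Fin (D + 1)) := fun s v =>
    ⟨min (s v) D, by omega⟩
  have hinj : Set.InjOn f R.support := by
    intro s hs s' hs' h
    ext v
    have hv := congrFun h v
    simp only [f, Fin.mk.injEq] at hv
    obtain ⟨h1, h2⟩ := apply_le_of_mem_support hs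
    obtain ⟨h1', h2'⟩ := apply_le_of_mem_support hs'
    rcases v with i | j
    · have := h1 i; have := h1' i
      rw [min_eq_left (by omega), min_eq_left (by omega)] at hv
      exact hv
    · have := h2 j; have := h2' j
      rw [min_eq_left (by omega), min_eq_left (by omega)] at hv
      exact hv
  calc R.support.card ≤ (Finset.univ : Finset (Fin d₀ ⊕ Fin d₁ → Fin (D + 1))).card :=
        Finset.card_le_card_of_injOn f (fun _ _ => Finset.mem_univ _) hinj
    _ = (D + 1) ^ (d₀ + d₁) := by simp [Fintype.card_sum]

end Generic

/-! ### Sizes in a number field -/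

section Sizes

open AlgSize

variable {k : Type*} [Field k] [NumberField k] {d₀ d₁ m : ℕ}
variable {d : ℤ} {C : ℝ}

/-- **One letter.** If the coefficients of `R` (`deg_X ≤ D₀`, `deg_Y ≤ D₁`) are good for
`(d, N, B)` and the coordinates of `w` for `(d, 1, C)`, `C ≥ 0`, then the coefficients of `D_w R`
are good for `(d, N + 1, B · C · (d₀ (D₀ + 1) + D₁ + 1))`. [folklore] -/
theorem isGood_coeff_invDeriv {N D₀ D₁ : ℕ} {B : ℝ} (hB : 0 ≤ B) (hC : 0 ≤ C)
    {w : (Fin d₀ → k) × (Fin d₁ → k)} (hw0 : ∀ i, IsGood d 1 C (w.1 i)) (hw1 : ∀ j, IsGood d 1 C (w.2 j))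
    {R : MvPolynomial (Fin d₀ ⊕ Fin d₁) k} (hX : degX R ≤ D₀) (hY : degY R ≤ D₁)
    (hR : ∀ s, IsGood d N B (coeff s R)) (s : Fin d₀ ⊕ Fin d₁ →₀ ℕ) :
    IsGood d (N + 1) (B * (C * ((d₀ : ℝ) * (D₀ + 1) + D₁ + 1))) (coeff s (invDeriv w R)) := by
  classical
  rw [coeff_invDeriv]
  -- the `X`-terms
  have hXt : ∀ i, IsGood d (N + 1) ((D₀ + 1 : ℝ) * (C * B))
      (((s (Sum.inl i) : k) + 1) * w.1 i * coeff (s + Finsupp.single (Sum.inl i) 1) R) := by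
    intro i
    by_cases h0 : coeff (s + Finsupp.single (Sum.inl i) 1) R = 0
    · rw [h0, mul_zero]
      exact IsGood.zero (by positivity)
    · have hsi : s (Sum.inl i) + 1 ≤ D₀ := by
        have := (apply_le_of_mem_support (mem_support_iff.2 h0)).1 i
        simp only [Finsupp.coe_add, Pi.add_apply, Finsupp.single_eq_same] at this
        exact this.trans hX
      have h1 : IsGood d (1 + N) (C * B) (w.1 i * coeff (s + Finsupp.single (Sum.inl i) 1) R) :=
        (hw0 i).mul (hR _)
      have h2 := h1.natCast_mul (s (Sum.inl i) + 1)
      rw [Nat.add_comm 1 N] at h2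
      push_cast at h2
      rw [mul_assoc]
      refine h2.mono (mul_le_mul_of_nonneg_right ?_ (by positivity))
      exact_mod_cast Nat.le_succ_of_le hsi
  -- the `Y`-term
  have hYt : IsGood d (N + 1) ((D₁ : ℝ) * C * B) ((∑ j, (s (Sum.inr j) : k) * w.2 j) * coeff s R) := by
    by_cases h0 : coeff s R = 0
    · rw [h0, mul_zero]
      exact IsGood.zero (by positivity)
    · have hsj : ∑ j, s (Sum.inr j) ≤ D₁ := (degY_le_iff.1 hY) s (mem_support_iff.2 h0)
      have h1 : IsGood d 1 (∑ j, (s (Sum.inr j) : ℝ) * C) (∑ j, (s (Sum.inr j) : k) * w.2 j) :=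
        IsGood.sum _ fun j _ => (hw1 j).natCast_mul _
      have h2 := h1.mul (hR s)
      rw [Nat.add_comm 1 N] at h2
      refine h2.mono (mul_le_mul_of_nonneg_right ?_ hB)
      rw [← Finset.sum_mul]
      refine mul_le_mul_of_nonneg_right ?_ hC
      exact_mod_cast hsj
  have hsum := (IsGood.sum_const (Finset.univ : Finset (Fin d₀)) fun i _ => hXt i).add hYt
  rw [Finset.card_univ, Fintype.card_fin] at hsum
  refine hsum.mono ?_
  have hCB : 0 ≤ C * B := mul_nonneg hC hB
  nlinarith [hCB, Nat.cast_nonneg (α := ℝ) d₀, Nat.cast_nonneg (α := ℝ) D₀, Nat.cast_nonneg (α := ℝ) D₁]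

/-- **Words.** With letters good for `(d, 1, C)`, `C ≥ 0`, and `R` with coefficients good for
`(d, N, B)`, `deg_X R ≤ D₀`, `deg_Y R ≤ D₁`: the coefficients of `D_u R` (`u` of length `ℓ`) are good
for `(d, N + ℓ, B (C (d₀(D₀+1) + D₁ + 1))^ℓ)`. [cite: Waldschmidt1988, §6 (p. 389)] -/
theorem isGood_coeff_wordDeriv {D₀ D₁ : ℕ} (hC : 0 ≤ C) {ℓ : ℕ}
    {u : Fin ℓ → (Fin d₀ → k) × (Fin d₁ → k)} (hu0 : ∀ l i, IsGood d 1 C ((u l).1 i))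
    (hu1 : ∀ l j, IsGood d 1 C ((u l).2 j)) {N : ℕ} {B : ℝ} (hB : 0 ≤ B)
    {R : MvPolynomial (Fin d₀ ⊕ Fin d₁) k} (hX : degX R ≤ D₀) (hY : degY R ≤ D₁)
    (hR : ∀ s, IsGood d N B (coeff s R)) (s : Fin d₀ ⊕ Fin d₁ →₀ ℕ) :
    IsGood d (N + ℓ) (B * (C * ((d₀ : ℝ) * (D₀ + 1) + D₁ + 1)) ^ ℓ) (coeff s (wordDeriv u R)) := by
  induction ℓ generalizing R N B s with
  | zero => simpa using hR s
  | succ ℓ ih =>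
    rw [wordDeriv_succ]
    have h1 : ∀ s', IsGood d (N + 1) (B * (C * ((d₀ : ℝ) * (D₀ + 1) + D₁ + 1)))
        (coeff s' (invDeriv (u (Fin.last ℓ)) R)) :=
      isGood_coeff_invDeriv hB hC (hu0 _) (hu1 _) hX hY hR
    have h2 := ih (u := fun l => u (Fin.castSucc l)) (fun l i => hu0 _ i) (fun l j => hu1 _ j)
      (by positivity) ((degX_invDeriv_le _ _).trans hX) ((degY_invDeriv_le _ _).trans hY) h1 s
    rw [show N + (ℓ + 1) = N + 1 + ℓ by omega,
      show B * (C * ((d₀ : ℝ) * (D₀ + 1) + D₁ + 1)) ^ (ℓ + 1) =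
        B * (C * ((d₀ : ℝ) * (D₀ + 1) + D₁ + 1)) * (C * ((d₀ : ℝ) * (D₀ + 1) + D₁ + 1)) ^ ℓ by ring]
    exact h2

omit [NumberField k] in
/-- The card of the support of a word. [folklore] -/
theorem card_support_wordDeriv_le {D₀ D₁ ℓ : ℕ} (u : Fin ℓ → (Fin d₀ → k) × (Fin d₁ → k))
    {R : MvPolynomial (Fin d₀ ⊕ Fin d₁) k} (hX : degX R ≤ D₀) (hY : degY R ≤ D₁) :
    (wordDeriv u R).support.card ≤ (max D₀ D₁ + 1) ^ (d₀ + d₁) := by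
  refine (card_support_le _).trans (Nat.pow_le_pow_left ?_ _)
  have := degX_wordDeriv_le u R
  have := degY_wordDeriv_le u R
  omega

/-! ### Evaluation at `γ(h)` -/

/-- The additive coordinates of `γ(h)` are good: `∑ᵢ hᵢ yᵢ⁰` with `hᵢ ≤ S` is good for
`(d, 1, m S C)`. [folklore] -/
theorem isGood_gammaOf_fst {y : Fin m → (Fin d₀ → k) × (Fin d₁ → k)} (hC : 0 ≤ C)
    (hy : ∀ i i₀, IsGood d 1 C ((y i).1 i₀)) {α : Fin m → Fin d₁ → kˣ} {S : ℕ} {h : Fin m → ℕ}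
    (hh : ∀ i, h i ≤ S) (i₀ : Fin d₀) :
    IsGood d 1 ((m : ℝ) * S * C)
      (Multiplicative.toAdd (gammaOf y α (Multiplicative.ofAdd fun i => (h i : ℤ))).1 i₀) := by
  rw [toAdd_gammaOf_fst, Finset.sum_apply]
  have h1 : ∀ i, IsGood d 1 ((S : ℝ) * C) ((((h i : ℤ) : k) • (y i).1) i₀) := by
    intro i
    rw [Pi.smul_apply, smul_eq_mul, Int.cast_natCast]
    refine ((hy i i₀).natCast_mul (h i)).mono (mul_le_mul_of_nonneg_right ?_ hC)
    exact_mod_cast hh i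
  have h2 := IsGood.sum_const (Finset.univ : Finset (Fin m)) fun i _ => h1 i
  rw [Finset.card_univ, Fintype.card_fin] at h2
  convert h2 using 1
  ring

/-- The multiplicative coordinates of `γ(h)` are good: `∏ᵢ αᵢⱼ^{hᵢ}` with `hᵢ ≤ S` is good for
`(d, m S, (|d| C)^{m S})` (`C ≥ 1`, `d ≠ 0`). [folklore] -/
theorem isGood_gammaOf_snd {y : Fin m → (Fin d₀ → k) × (Fin d₁ → k)} (hC : 1 ≤ C) (hd : d ≠ 0)
    {α : Fin m → Fin d₁ → kˣ} (hα : ∀ i j, IsGood d 1 C (α i j : k)) {S : ℕ} {h : Fin m → ℕ}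
    (hh : ∀ i, h i ≤ S) (j : Fin d₁) :
    IsGood d (m * S) ((|(d : ℝ)| * C) ^ (m * S))
      ((gammaOf y α (Multiplicative.ofAdd fun i => (h i : ℤ))).2 j : k) := by
  rw [gammaOf_snd, Units.coe_prod]
  have h1 : ∀ i, IsGood d S ((|(d : ℝ)| * C) ^ S) (((α i j ^ ((fun i => (h i : ℤ)) i) : kˣ) : k)) := by
    intro i
    simp only [zpow_natCast, Units.val_pow_eq_pow_val]
    have h2 := ((hα i j).pow (h i)).raise_to (N₁ := S) (by simpa using hh i) hd
    refine h2.mono ?_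
    rw [mul_pow]
    refine mul_le_mul_of_nonneg_left (pow_le_pow_right₀ hC (hh i)) (by positivity)
  have h3 := IsGood.prod (Finset.univ : Finset (Fin m)) fun i _ => h1 i
  rw [Finset.sum_const, Finset.prod_const, Finset.card_univ, Fintype.card_fin, smul_eq_mul, ← pow_mul]
    at h3
  rwa [Nat.mul_comm S m] at h3

/-- **The value of a polynomial at `γ(h)`.** If the coefficients of `R` (`deg_X ≤ D₀`, `deg_Y ≤ D₁`)
are good for `(d, N, B)`, the `yᵢ⁰` and `αᵢⱼ` for `(d, 1, C)` (`C ≥ 1`, `d ≠ 0`) and `hᵢ ≤ S`,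
then `R(γ(h))` is good for
`(d, N + (D₀ + D₁ m S), (max(D₀,D₁)+1)^{d₀+d₁} · B · (|d|(m S C + 1))^{D₀} · (|d|² C)^{m S D₁})`.
[cite: Waldschmidt1988, §6 (p. 389)] -/
theorem isGood_evalAt_gammaOf {y : Fin m → (Fin d₀ → k) × (Fin d₁ → k)} (hC : 1 ≤ C) (hd : d ≠ 0)
    (hy : ∀ i i₀, IsGood d 1 C ((y i).1 i₀)) {α : Fin m → Fin d₁ → kˣ}
    (hα : ∀ i j, IsGood d 1 C (α i j : k)) {S : ℕ} {h : Fin m → ℕ} (hh : ∀ i, h i ≤ S)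
    {N D₀ D₁ : ℕ} {B : ℝ} (hB : 0 ≤ B) {R : MvPolynomial (Fin d₀ ⊕ Fin d₁) k} (hX : degX R ≤ D₀)
    (hY : degY R ≤ D₁) (hR : ∀ s, IsGood d N B (coeff s R)) :
    IsGood d (N + (D₀ + D₁ * (m * S)))
      ((((max D₀ D₁ + 1) ^ (d₀ + d₁) : ℕ) : ℝ) * (B * (((|(d : ℝ)|) * ((m : ℝ) * S * C + 1)) ^ D₀ *
        ((|(d : ℝ)|) ^ 2 * C) ^ (m * S * D₁))))
      (evalAt R (gammaOf y α (Multiplicative.ofAdd fun i => (h i : ℤ)))) := by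
  classical
  have hd1 : (1 : ℝ) ≤ |(d : ℝ)| := by
    rw [← Int.cast_abs]; exact_mod_cast Int.one_le_abs hd
  have hC0 : (0 : ℝ) ≤ C := zero_le_one.trans hC
  set g := gammaOf y α (Multiplicative.ofAdd fun i => (h i : ℤ)) with hg
  set XB : ℝ := ((|(d : ℝ)|) * ((m : ℝ) * S * C + 1)) ^ D₀ with hXB
  set YB : ℝ := ((|(d : ℝ)|) ^ 2 * C) ^ (m * S * D₁) with hYB
  -- coordinates
  have hcX : ∀ i₀, IsGood d 1 ((m : ℝ) * S * C) (coord g (Sum.inl i₀)) := fun i₀ =>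
    isGood_gammaOf_fst hC0 hy (α := α) hh i₀
  have hcY : ∀ j, IsGood d (m * S) ((|(d : ℝ)| * C) ^ (m * S)) (coord g (Sum.inr j)) := fun j =>
    isGood_gammaOf_snd (y := y) hC hd hα hh j
  -- monomials of the support
  have hmono : ∀ s ∈ R.support, IsGood d (D₀ + D₁ * (m * S)) (XB * YB) (∏ v, coord g v ^ s v) := by
    intro s hs
    obtain ⟨hs0, hs1⟩ := apply_le_of_mem_support hs
    have hsX : ∑ i, s (Sum.inl i) ≤ D₀ := (degX_le_iff.1 hX) s hs
    have hsY : ∑ j, s (Sum.inr j) ≤ D₁ := (degY_le_iff.1 hY) s hs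
    rw [Fintype.prod_sum_type]
    -- `X`-part
    have hPX : IsGood d D₀ XB (∏ i₀, coord g (Sum.inl i₀) ^ s (Sum.inl i₀)) := by
      have h1 := IsGood.prod (Finset.univ : Finset (Fin d₀)) fun i₀ _ => (hcX i₀).pow (s (Sum.inl i₀))
      simp only [mul_one] at h1
      have h2 := h1.raise_to (N₁ := D₀) hsX hd
      refine h2.mono ?_
      rw [hXB, mul_pow, Finset.prod_pow_eq_pow_sum]
      refine mul_le_mul_of_nonneg_left ?_ (by positivity)
      calc ((m : ℝ) * S * C) ^ (∑ i, s (Sum.inl i)) ≤ ((m : ℝ) * S * C + 1) ^ (∑ i, s (Sum.inl i)) :=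
            pow_le_pow_left₀ (by positivity) (by linarith) _
        _ ≤ ((m : ℝ) * S * C + 1) ^ D₀ := pow_le_pow_right₀ (by linarith [show (0:ℝ) ≤ m * S * C by positivity]) hsX
    -- `Y`-part
    have hPY : IsGood d (D₁ * (m * S)) YB (∏ j, coord g (Sum.inr j) ^ s (Sum.inr j)) := by
      have h1 := IsGood.prod (Finset.univ : Finset (Fin d₁)) fun j _ => (hcY j).pow (s (Sum.inr j))
      have hN : ∑ j, s (Sum.inr j) * (m * S) ≤ D₁ * (m * S) := by
        rw [← Finset.sum_mul]; exact Nat.mul_le_mul_right _ hsY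
      have h2 := h1.raise_to (N₁ := D₁ * (m * S)) hN hd
      refine h2.mono ?_
      rw [hYB, Finset.prod_pow_eq_pow_sum]
      have hdC : (1 : ℝ) ≤ |(d : ℝ)| * C := one_le_mul_of_one_le_of_one_le hd1 hC
      calc |(d : ℝ)| ^ (D₁ * (m * S)) * ((|(d : ℝ)| * C) ^ (m * S)) ^ (∑ j, s (Sum.inr j))
          ≤ |(d : ℝ)| ^ (D₁ * (m * S)) * ((|(d : ℝ)| * C) ^ (m * S)) ^ D₁ := by
            refine mul_le_mul_of_nonneg_left (pow_le_pow_right₀ (one_le_pow₀ hdC) hsY) (by positivity)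
        _ = ((|(d : ℝ)|) ^ 2 * C) ^ (m * S * D₁) := by ring
    exact hPX.mul hPY
  -- the sum over the support
  rw [evalAt_eq_eval, eval_eq']
  have hterm : ∀ s ∈ R.support, IsGood d (N + (D₀ + D₁ * (m * S))) (B * (XB * YB))
      (coeff s R * ∏ v, coord g v ^ s v) := fun s hs => (hR s).mul (hmono s hs)
  have hsum := IsGood.sum_const R.support hterm
  refine hsum.mono ?_
  have hcard : (R.support.card : ℝ) ≤ (((max D₀ D₁ + 1) ^ (d₀ + d₁) : ℕ) : ℝ) := by
    have := card_support_le R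
    have hmax : max (degX R) (degY R) + 1 ≤ max D₀ D₁ + 1 := by omega
    exact_mod_cast this.trans (Nat.pow_le_pow_left hmax _)
  have hpos : 0 ≤ B * (XB * YB) := by positivity
  calc (R.support.card : ℝ) * (B * (XB * YB)) ≤ (((max D₀ D₁ + 1) ^ (d₀ + d₁) : ℕ) : ℝ) * (B * (XB * YB)) :=
        mul_le_mul_of_nonneg_right hcard hpos
    _ = _ := by rw [hXB, hYB]

end Sizes

end LinGroupK

end Literature.NumberTheory.Transcendental
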